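import Summits.ValiantsHypothesis.ValiantsHypothesis.Theorems.LacunarySymmetroidMatrixDescartesPencilTrailingCoeffs
import Summits.ValiantsHypothesis.ValiantsHypothesis.Theorems.LacunarySymmetroidMatrixDescartesWLawDescartes
import Summits.ValiantsHypothesis.ValiantsHypothesis.Theorems.LacunarySymmetroidMatrixDescartesWLawArrow
import Summits.ValiantsHypothesis.ValiantsHypothesis.Theorems.LacunarySymmetroidMatrixDescartesWLawTwoSignBudgets
import Literature.Algebra.Polynomial.SparseCurveLineSharpBound

/-!
# `MatrixDescartes` (stmt-ValiantsHypothesis-18050) — THE FOUR-LETTER COLUMN IS NEVER DESCARTES-SHARP: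
# `WLawAt n (C(n+3,3) − 2)` for every `n ≥ 1`, `w(1) = 2` exactly, `w(3) ≤ 18`

HONEST FRAMING.  Cell `pub-symmetroid`, seat `val-sym-mdr-p2` (gen 26); helper file `--supports` the crux
`Theses.LacunarySymmetroid.MatrixDescartes` (OPEN), NO closure claim.  Object: the typed W-rows `WLawAt n B` of `…WLawDefs`
(seat gen 4; every `n × n` W-configuration `X^e J + X^{d₁} P₁ + X^{d₂} P₂ + X^{d₃} Q`, `d₂ < d₁ < e < d₃`, `J` real symmetric,
`P₁, P₂, Q ⪰ 0`, has at most `B` distinct positive determinant zeros) and the column `w(n) := min {B | WLawAt n B}`, whose kernel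
bracket before this file was `4n − 2 ≤ w(n) ≤ C(n+3, 3) − 1` (`four_mul_sub_two_le_of_wLawAt_all`, gen 8; `wLawAt_descartes`,
gen 7 — the plain count-vector Descartes ceiling, in which «no symmetry, no semidefiniteness and no ordering of the exponents is used»).

WHAT IS PROVED (the first use of SEMIDEFINITENESS on the upper side of the column, valid at every size):
* SIGN-VARIATION BOOKKEEPING (ns `WLawNotSharp`): `signVariations_add_one_le_card_support` (`V(f) + 1 ≤ #supp f` for `f ≠ 0`),
  `signVariations_le_card_support_of_top_two_nonneg` / `…_of_bot_two_nonneg` (two non-negative coefficients ABOVE, resp. BELOW,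
  the rest of the support cost nothing: `V(C a · X^D + C b · X^{D'} + R) ≤ #supp R` for `0 ≤ a, b`; the bottom version by the
  tree's reflection invariance `signVariations_reflect`).
* `signVariations_det_pencil_le_of_bot_two_nonneg` — a lacunary pencil of size `m + 1` with `K` letters whose two lowest letters
  `l₀, l₁` (strictly ordered exponents) have `det (S l₀) ≥ 0` and `tr (adj (S l₀) · S l₁) ≥ 0` has `V(det) ≤ C(m+K, m+1) − 2`: the two
  trailing coefficients are exactly these numbers (companion `…PencilTrailingCoeffs`), every other exponent is larger, and both
  trailing exponents are count-vector sums.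
* **`card_posRoots_det_pencil_le_of_bot_two_posSemidef`** (pencil currency, any size `m + 1`, any `K`, the other letters ARBITRARY
  real): two PSD letters on the two strictly lowest exponents ⇒ `Z₊ ≤ C(m+K, m+1) − 2`.
* THE ROWS: **`wLawAt_choose_sub_two : 1 ≤ n → WLawAt n (C(n+3, n) − 2)`** — for a W-pencil the two lowest letters are `P₂, P₁ ⪰ 0`
  (`det P₂ ≥ 0`, `tr (adj P₂ · P₁) ≥ 0` by `TrailingCoeffs.trace_adjugate_mul_nonneg`), so a W-row is never Descartes-sharp; at
  `n = 1` this is the exact value (**`wLawAt_one_iff : WLawAt 1 B ↔ 2 ≤ B`**, with gen 8's lower row), and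
  **`wLawAt_three_eighteen : WLawAt 3 18`** (kernel bracket `10 ≤ w(3) ≤ 18`, `wLawAt_three_bracket'`).
Chamber by chamber more adjacent PSD-only exponents occur at the bottom (`(n−k)·d₂ + k·d₁ < (n−1)·d₂ + e` whenever
`k·(d₁−d₂) < e−d₂`), each costing one more sign variation; only the uniform saving is filed here.  Nothing here bears on
`MatrixDescartes` in its window, on `stub_twoSided`, on `DoorA26` / `DoorA34`, on the cell's registers, or on `VP ≠ VNP`.

[folklore] Descartes' rule of signs (Mathlib `Polynomial.roots_countP_pos_le_signVariations`, `signVariations_eq_eraseLead_add_ite`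
through the tree's `Literature.Algebra.Polynomial.signVariations_C_mul_X_pow_add`), reflection (`signVariations_reflect`), the count-vector
support of the tree's `StubDescartesCeiling`.  No definitions, no named facts.
-/

-- `Summit.ValiantsHypothesis.ValiantsHypothesis.…` repeats a component by the single-conjunct
-- summit layout, which the `dupNamespace` linter flags; the name is mandated.
set_option linter.dupNamespace false

namespace Summit.ValiantsHypothesis.ValiantsHypothesis.Theorems.LacunarySymmetroidMatrixDescartes

open Polynomial Finset Matrix TrailingCoeffs
open scoped BigOperators Polynomial Matrix

namespace WLawNotSharp

variable {K m : ℕ}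

/-! ### 1. Sign-variation bookkeeping -/

/-- `V(f) + 1 ≤ #supp f` for `f ≠ 0` (at most one sign change per pair of consecutive non-zero coefficients). [folklore] -/
theorem signVariations_add_one_le_card_support {f : ℝ[X]} (hf : f ≠ 0) :
    f.signVariations + 1 ≤ f.support.card := by
  induction h : f.support.card using Nat.strong_induction_on generalizing f with
  | _ k ih =>
    subst h
    by_cases he : f.eraseLead = 0
    · -- `f` is a monomial
      have hmon : f = C f.leadingCoeff * X ^ f.natDegree := by
        have := f.eraseLead_add_C_mul_X_pow
        rw [he, zero_add] at this
        exact this.symm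
      have hcard : (C f.leadingCoeff * X ^ f.natDegree).support.card = f.support.card := by rw [← hmon]
      rw [hmon, C_mul_X_pow_eq_monomial, signVariations_monomial, zero_add, ← C_mul_X_pow_eq_monomial, hcard]
      exact Nat.one_le_iff_ne_zero.mpr fun h0 => hf (Polynomial.card_support_eq_zero.mp h0)
    · have hlt : f.eraseLead.support.card < f.support.card := by
        have := card_support_eraseLead_add_one hf; omega
      have hrec := ih _ hlt he rfl
      have hstep := f.signVariations_le_eraseLead_succ
      have := card_support_eraseLead_add_one hf
      omega

/-- `V(f) ≤ #supp f` (trivially for `f = 0`). [folklore] -/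
theorem signVariations_le_card_support (f : ℝ[X]) : f.signVariations ≤ f.support.card := by
  by_cases hf : f = 0
  · simp [hf]
  · exact (Nat.le_succ _).trans (signVariations_add_one_le_card_support hf)

/-- TOP version: two non-negative coefficients ABOVE the rest cost nothing: `deg R < D' < D`, `0 ≤ a`, `0 ≤ b` ⇒
`V(C a · X^D + C b · X^{D'} + R) ≤ #supp R`. [folklore] -/
theorem signVariations_le_card_support_of_top_two_nonneg {a b : ℝ} (ha : 0 ≤ a) (hb : 0 ≤ b) {D D' : ℕ} (hD : D' < D)
    {R : ℝ[X]} (hR : R.degree < D') :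
    (C a * X ^ D + C b * X ^ D' + R).signVariations ≤ R.support.card := by
  have hDD : ((D' : ℕ) : WithBot ℕ) < ((D : ℕ) : WithBot ℕ) := by exact_mod_cast hD
  have hR' : (C b * X ^ D' + R).degree < ((D : ℕ) : WithBot ℕ) :=
    (degree_add_le _ _).trans_lt (max_lt ((degree_C_mul_X_pow_le D' b).trans_lt hDD) (hR.trans hDD))
  -- the inner polynomial `C b X^{D'} + R`
  have hinner : (C b * X ^ D' + R).signVariations ≤ R.support.card := by
    rcases hb.eq_or_lt with hb0 | hb0
    · rw [← hb0, C_0, zero_mul, zero_add]; exact signVariations_le_card_support R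
    · by_cases hR0 : R = 0
      · rw [hR0, add_zero, C_mul_X_pow_eq_monomial, signVariations_monomial]; exact Nat.zero_le _
      · exact (Literature.Algebra.Polynomial.signVariations_C_mul_X_pow_add_le hb0.ne' hR).trans
          (signVariations_add_one_le_card_support hR0)
  rcases ha.eq_or_lt with ha0 | ha0
  · rw [← ha0, C_0, zero_mul, zero_add]; exact hinner
  rw [add_assoc, Literature.Algebra.Polynomial.signVariations_C_mul_X_pow_add ha0.ne' hR']
  rcases hb.eq_or_lt with hb0 | hb0
  · -- `b = 0`: `V = V(R) + [·] ≤ V(R) + 1 ≤ #supp R` (or `R = 0`)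
    subst hb0
    rw [C_0, zero_mul, zero_add] at *
    by_cases hR0 : R = 0
    · subst hR0; simp [ha0.ne']
    · calc R.signVariations + (if SignType.sign a = -SignType.sign R.leadingCoeff then 1 else 0)
          ≤ R.signVariations + 1 := by gcongr; split_ifs <;> simp
        _ ≤ R.support.card := signVariations_add_one_le_card_support hR0
  · -- `b > 0`: the leading coefficient of the inner polynomial is `b > 0`, same sign as `a`
    have hlead : (C b * X ^ D' + R).leadingCoeff = b := by
      rw [add_comm, leadingCoeff_add_of_degree_lt, leadingCoeff_C_mul_X_pow]
      rwa [degree_C_mul_X_pow D' hb0.ne']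
    rw [hlead, if_neg, add_zero]
    · exact hinner
    · rw [sign_pos ha0, sign_pos hb0]; decide

/-- BOTTOM version (by reflection, tree `signVariations_reflect`): two non-negative coefficients BELOW the rest cost nothing:
`0 ≤ a`, `0 ≤ b`, `D < D'` and every exponent of `R` exceeds `D'` ⇒ `V(C a · X^D + C b · X^{D'} + R) ≤ #supp R`. [folklore] -/
theorem signVariations_le_card_support_of_bot_two_nonneg {a b : ℝ} (ha : 0 ≤ a) (hb : 0 ≤ b) {D D' : ℕ} (hD : D < D')
    {R : ℝ[X]} (hR : ∀ i ∈ R.support, D' < i) :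
    (C a * X ^ D + C b * X ^ D' + R).signVariations ≤ R.support.card := by
  classical
  set N := max D' R.natDegree with hN
  have hDN : D ≤ N := hD.le.trans (le_max_left _ _)
  have hD'N : D' ≤ N := le_max_left _ _
  have hRN : R.natDegree ≤ N := le_max_right _ _
  have hdeg : (C a * X ^ D + C b * X ^ D' + R).natDegree ≤ N := by
    refine (natDegree_add_le _ _).trans (max_le ((natDegree_add_le _ _).trans (max_le ?_ ?_)) hRN)
    · exact (natDegree_C_mul_X_pow_le a D).trans hDN
    · exact (natDegree_C_mul_X_pow_le b D').trans hD'N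
  rw [← Literature.Algebra.Polynomial.signVariations_reflect _ hdeg, reflect_add, reflect_add,
    reflect_C_mul_X_pow, reflect_C_mul_X_pow, revAt_le hDN, revAt_le hD'N]
  -- reflected: `C a X^{N−D} + C b X^{N−D'} + reflect N R`, top two, `deg (reflect N R) < N − D'`
  have hsupp : (reflect N R).support.card = R.support.card := by
    rw [reflect_support, Finset.card_image_of_injective _ (revAt N).injective]
  have hRdeg : (reflect N R).degree < ((N - D' : ℕ) : WithBot ℕ) := by
    rw [degree_lt_iff_coeff_zero]
    intro i hi
    rw [coeff_reflect]
    by_contra hne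
    have hmem : revAt N i ∈ R.support := mem_support_iff.mpr hne
    have h1 := hR _ hmem
    have h2 : revAt N i ≤ R.natDegree := le_natDegree_of_mem_supp _ hmem
    have hiN : i ≤ N := by
      by_contra hcon
      push Not at hcon
      have : revAt N i = i := by
        unfold revAt; simp [Function.Embedding.coeFn_mk, Nat.not_le.mpr hcon]
      rw [this] at h2; omega
    rw [revAt_le hiN] at h1
    have : (N - D' : ℕ) ≤ i := by exact_mod_cast hi
    omega
  rw [← hsupp]
  exact signVariations_le_card_support_of_top_two_nonneg ha hb (by omega) hRdeg

/-! ### 2. The W-rows are never Descartes-sharp -/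

/-- **Sign variations of a pencil determinant with two non-negative trailing coefficients.**  Size `m + 1`, `K ≥ 1` letters,
`l₀` / `l₁` the strictly smallest / second smallest exponents, `0 ≤ det (S l₀)` and `0 ≤ tr (adj (S l₀) · S l₁)`:
`V(det) ≤ C(m+K, m+1) − 2`. [folklore] -/
theorem signVariations_det_pencil_le_of_bot_two_nonneg (hK : 0 < K) (d : Fin K → ℕ)
    (S : Fin K → Matrix (Fin (m + 1)) (Fin (m + 1)) ℝ) {l₀ l₁ : Fin K} (h01 : d l₀ < d l₁)
    (hbot : ∀ l, l ≠ l₀ → d l₀ < d l) (hnext : ∀ l, l ≠ l₀ → l ≠ l₁ → d l₁ < d l)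
    (h0 : 0 ≤ (S l₀).det) (h1 : 0 ≤ ((S l₀).adjugate * S l₁).trace) :
    (Matrix.det (∑ l, ((X : ℝ[X]) ^ d l) • (S l).map C)).signVariations ≤ Nat.choose (m + 1 + K - 1) (m + 1) - 2 := by
  classical
  set F := Matrix.det (∑ l, ((X : ℝ[X]) ^ d l) • (S l).map C) with hF
  set D₀ := (m + 1) * d l₀ with hD₀
  set D₁ := m * d l₀ + d l₁ with hD₁
  have hD : D₀ < D₁ := by rw [hD₀, hD₁, Nat.succ_mul]; exact Nat.add_lt_add_left h01 _
  set R := F - C (S l₀).det * X ^ D₀ - C ((S l₀).adjugate * S l₁).trace * X ^ D₁ with hR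
  have hc0 : F.coeff D₀ = (S l₀).det := coeff_det_pencil_bot d S hbot
  have hc1 : F.coeff D₁ = ((S l₀).adjugate * S l₁).trace := coeff_det_pencil_botNext d S h01 hnext
  have hFR : F = C (S l₀).det * X ^ D₀ + C ((S l₀).adjugate * S l₁).trace * X ^ D₁ + R := by rw [hR]; ring
  -- the support of `R`
  have hRsupp : ∀ E ∈ R.support, D₁ < E := by
    intro E hE
    have hcoeff : R.coeff E ≠ 0 := mem_support_iff.mp hE
    have hRE : R.coeff E = F.coeff E - (if E = D₀ then (S l₀).det else 0)
        - (if E = D₁ then ((S l₀).adjugate * S l₁).trace else 0) := by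
      rw [hR, coeff_sub, coeff_sub, coeff_C_mul_X_pow, coeff_C_mul_X_pow]
    by_cases hE0 : E = D₀
    · exfalso; apply hcoeff
      rw [hRE, hE0, if_pos rfl, if_neg hD.ne, hc0]; ring
    by_cases hE1 : E = D₁
    · exfalso; apply hcoeff
      rw [hRE, hE1, if_neg hD.ne', if_pos rfl, hc1]; ring
    have hEF : E ∈ F.support := by
      rw [mem_support_iff]
      intro hz
      apply hcoeff
      rw [hRE, hz, if_neg hE0, if_neg hE1]; ring
    exact botNext_lt_of_mem_support d S h01 hnext hEF hE0 hE1
  have hRsub : R.support ⊆ (F.support.erase D₀).erase D₁ := by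
    intro E hE
    have hlt := hRsupp E hE
    have hcoeff : R.coeff E ≠ 0 := mem_support_iff.mp hE
    refine Finset.mem_erase.mpr ⟨hlt.ne', Finset.mem_erase.mpr ⟨(hD.trans hlt).ne', mem_support_iff.mpr fun hz => hcoeff ?_⟩⟩
    rw [hR, coeff_sub, coeff_sub, coeff_C_mul_X_pow, coeff_C_mul_X_pow, hz, if_neg (hD.trans hlt).ne',
      if_neg hlt.ne']; ring
  -- the exponent image of the count vectors contains both trailing exponents
  set I := (Finset.univ : Finset (Sym (Fin K) (m + 1))).image
      (fun s : Sym (Fin K) (m + 1) => ((s : Multiset (Fin K)).map d).sum) with hI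
  have hmemI : ∀ f : Fin (m + 1) → Fin K, (∑ i, d (f i)) ∈ I := fun f =>
    Finset.mem_image.mpr ⟨⟨Finset.univ.val.map f, StubDescartesCeiling.card_map_univ_val f⟩, Finset.mem_univ _,
      (StubDescartesCeiling.sum_eq_sym_sum d f).symm⟩
  have hD₀I : D₀ ∈ I := by rw [hD₀, ← sum_const_letter d l₀]; exact hmemI _
  have hD₁I : D₁ ∈ I := by
    rw [hD₁, ← sum_update_letter d l₀ l₁ (0 : Fin (m + 1))]; exact hmemI _
  have hIcard : I.card ≤ Nat.choose (m + 1 + K - 1) (m + 1) :=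
    calc I.card ≤ (Finset.univ : Finset (Sym (Fin K) (m + 1))).card := Finset.card_image_le
      _ = Nat.choose (m + 1 + K - 1) (m + 1) := by
          rw [Finset.card_univ, Sym.card_sym_eq_choose, Fintype.card_fin]
          congr 1; omega
  have hRcard : R.support.card ≤ Nat.choose (m + 1 + K - 1) (m + 1) - 2 := by
    have hsub : R.support ⊆ (I.erase D₀).erase D₁ := hRsub.trans
      (Finset.erase_subset_erase _ (Finset.erase_subset_erase _ (StubDescartesCeiling.support_det_pencil_subset d S)))
    have := Finset.card_le_card hsub
    rw [Finset.card_erase_of_mem (Finset.mem_erase.mpr ⟨hD.ne', hD₁I⟩), Finset.card_erase_of_mem hD₀I] at this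
    omega
  rw [hFR]
  exact (signVariations_le_card_support_of_bot_two_nonneg h0 h1 hD hRsupp).trans hRcard

/-- **Root form (pencil currency, any size, any number of letters).**  A lacunary pencil `∑ l, X^{d l} • S l` of size `m + 1` whose two
lowest exponents are carried by POSITIVE SEMIDEFINITE letters `S l₀, S l₁` (`d l₀ < d l₁ <` every other exponent; the other letters
arbitrary real) has at most `C(m+K, m+1) − 2` distinct positive determinant zeros — one less than the count-vector Descartes ceiling
`stub_descartesCeiling`.  (The mirror statement for the two HIGHEST exponents follows by reflecting the exponents; not filed.) [folklore] -/
theorem card_posRoots_det_pencil_le_of_bot_two_posSemidef (hK : 0 < K) (d : Fin K → ℕ)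
    (S : Fin K → Matrix (Fin (m + 1)) (Fin (m + 1)) ℝ) {l₀ l₁ : Fin K} (h01 : d l₀ < d l₁)
    (hbot : ∀ l, l ≠ l₀ → d l₀ < d l) (hnext : ∀ l, l ≠ l₀ → l ≠ l₁ → d l₁ < d l)
    (h0 : (S l₀).PosSemidef) (h1 : (S l₁).PosSemidef) :
    ((Matrix.det (∑ l, ((X : ℝ[X]) ^ d l) • (S l).map C)).roots.toFinset.filter (fun t => 0 < t)).card
      ≤ Nat.choose (m + 1 + K - 1) (m + 1) - 2 :=
  (WLawTwoChambers.card_posRoots_le_signVariations _).trans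
    (signVariations_det_pencil_le_of_bot_two_nonneg hK d S h01 hbot hnext h0.det_nonneg (trace_adjugate_mul_nonneg h0 h1))

end WLawNotSharp

open WLawNotSharp

/-- **THE W-ROWS ARE NEVER DESCARTES-SHARP**: `WLawAt n (C(n+3, n) − 2)` for every `n ≥ 1` — the two trailing coefficients
`det P₂` (at `X^{n d₂}`) and `tr (adj P₂ · P₁)` (at `X^{(n−1) d₂ + d₁}`) of a W-pencil are non-negative by semidefiniteness, so
Descartes' count drops by one against the count-vector ceiling `C(n+3, n) − 1` of `wLawAt_descartes`. [folklore] -/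
theorem wLawAt_choose_sub_two {n : ℕ} (hn : 1 ≤ n) : WLawAt n (Nat.choose (n + 3) n - 2) := by
  obtain ⟨m, rfl⟩ := Nat.exists_eq_add_of_le' hn
  intro e d₁ d₂ d₃ J P₁ P₂ Q _ hP₁ hP₂ _ h21 h1e he3
  rw [wPencil_eq_sum_four]
  have hbot : ∀ l : Fin 4, l ≠ 2 → (![e, d₁, d₂, d₃] : Fin 4 → ℕ) 2 < (![e, d₁, d₂, d₃] : Fin 4 → ℕ) l := by
    intro l hl
    fin_cases l <;> simp at hl ⊢ <;> omega
  have hnext : ∀ l : Fin 4, l ≠ 2 → l ≠ 1 →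
      (![e, d₁, d₂, d₃] : Fin 4 → ℕ) 1 < (![e, d₁, d₂, d₃] : Fin 4 → ℕ) l := by
    intro l hl hl'
    fin_cases l <;> simp at hl hl' ⊢ <;> omega
  have h01 : (![e, d₁, d₂, d₃] : Fin 4 → ℕ) 2 < (![e, d₁, d₂, d₃] : Fin 4 → ℕ) 1 := by simpa using h21
  have h0 : 0 ≤ ((![J, P₁, P₂, Q] : Fin 4 → Matrix (Fin (m + 1)) (Fin (m + 1)) ℝ) 2).det := by
    simpa using hP₂.det_nonneg
  have h1 : 0 ≤ (((![J, P₁, P₂, Q] : Fin 4 → Matrix (Fin (m + 1)) (Fin (m + 1)) ℝ) 2).adjugate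
      * (![J, P₁, P₂, Q] : Fin 4 → Matrix (Fin (m + 1)) (Fin (m + 1)) ℝ) 1).trace := by
    simpa using trace_adjugate_mul_nonneg hP₂ hP₁
  have hV := signVariations_det_pencil_le_of_bot_two_nonneg (by norm_num) (![e, d₁, d₂, d₃] : Fin 4 → ℕ)
    (![J, P₁, P₂, Q] : Fin 4 → Matrix (Fin (m + 1)) (Fin (m + 1)) ℝ) h01 hbot hnext h0 h1
  have h43 : m + 1 + 4 - 1 = m + 1 + 3 := by omega
  rw [h43] at hV
  exact (WLawTwoChambers.card_posRoots_le_signVariations _).trans hV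

/-- `n = 1`: `WLawAt 1 2` (`C(4,1) − 2 = 2`). [bookkeeping] -/
theorem wLawAt_one_two : WLawAt 1 2 := by
  have h := wLawAt_choose_sub_two (le_refl 1)
  norm_num [Nat.choose] at h
  exact h

/-- **`w(1) = 2` EXACTLY**: `WLawAt 1 B ↔ 2 ≤ B` (upper side `wLawAt_one_two`; lower side gen 8's `4n − 2 ≤ B`). [bookkeeping] -/
theorem wLawAt_one_iff (B : ℕ) : WLawAt 1 B ↔ 2 ≤ B :=
  ⟨fun h => by simpa using four_mul_sub_two_le_of_wLawAt_all (le_refl 1) h, fun h => wLawAt_mono wLawAt_one_two h⟩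

/-- `n = 3`: `WLawAt 3 18` (`C(6,3) − 2 = 18`; the kernel bracket of `w(3)` becomes `10 ≤ w(3) ≤ 18`). [bookkeeping] -/
theorem wLawAt_three_eighteen : WLawAt 3 18 := by
  have h := wLawAt_choose_sub_two (show 1 ≤ 3 by norm_num)
  norm_num [Nat.choose] at h
  exact h

/-- The kernel bracket of the `n = 3` W-row after this file: `(WLawAt 3 B → 10 ≤ B) ∧ (18 ≤ B → WLawAt 3 B)`. [bookkeeping] -/
theorem wLawAt_three_bracket' (B : ℕ) : (WLawAt 3 B → 10 ≤ B) ∧ (18 ≤ B → WLawAt 3 B) :=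
  ⟨(wLawAt_three_bracket B).1, fun h => wLawAt_mono wLawAt_three_eighteen h⟩

end Summit.ValiantsHypothesis.ValiantsHypothesis.Theorems.LacunarySymmetroidMatrixDescartes
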